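import Literature.Probability.Percolation.BondInterfaceFaceDomainULC
import HarnessLib

/-!
# Face kernel (K1), colouring of the boundary sites near interior points of the two arcs

Route `CardyComplexCone` (sub-problem `CriticalPhenomena/CardyFormulaZ2`), crux
`Summit.CriticalPhenomena.CardyFormulaZ2.Theses.CardyComplexCone.ParafermionToSLESixFamilies`
(item stmt-CriticalPhenomena-11389), line `face-kernel-k1` (lead c4), helpers of the assembly stub
`stub_percFaceK1_of`.

For a discretisation family `Λ` of a Dobrushin domain `(D; a, b)` the discrete arcs
`zdArcA`, `zdArcB` of the datum `Λ δ` are cut out of the square-lattice boundary `zdBoundary` by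
comparing distances to the continuum arc data `(Λ δ).arcA`, `(Λ δ).arcB`, which converge to the
boundary arcs `D.arc 0`, `D.arc 1` in Hausdorff distance. Consequently, for small mesh, a site
whose mesh point is close to a boundary point `b'` far from `D.arc 0` is NOT on the discrete arc of
`A` (`eventually_not_mem_zdArcA`), and symmetrically near a point far from `D.arc 1` it is not on
the discrete arc of `B` (`eventually_not_mem_zdArcB`).
-/

noncomputable section

open scoped Topology ENNReal
open Filter Set Metric
open Literature.Probability Literature.Probability.LatticeModels Literature.Probability.Percolation
open Literature.Probability.LatticeModels.DiscreteDobrushin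
open Literature.Probability.RandomPlanarGeometry

namespace Summit.CriticalPhenomena.CardyFormulaZ2.Cruxes.ParafermionToSLESixFamilies.FaceKernel

variable {E : DiscreteDobrushin}

/-- For admissible data the continuum arc datum `arcA` is nonempty: otherwise every boundary site
would be on the discrete arc of `A` (the distance to `∅` is `0`), in particular the nonempty
discrete arc of `B`, contradicting disjointness. -/
theorem arcA_nonempty (hE : E.IsZdAdmissible) : E.arcA.Nonempty := by
  by_contra h
  rw [Set.not_nonempty_iff_eq_empty] at h
  have hall : E.zdArcB ⊆ E.zdArcA := by
    intro x hx
    refine ⟨E.zdArcB_subset_zdBoundary hx, ?_⟩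
    rw [h, Metric.infDist_empty]
    exact Metric.infDist_nonneg
  obtain ⟨x, hx⟩ := hE.zdArcB_nonempty
  exact Set.disjoint_left.1 hE.disjoint (hall hx) hx

/-- For admissible data the continuum arc datum `arcB` is nonempty (symmetric to
`arcA_nonempty`). -/
theorem arcB_nonempty (hE : E.IsZdAdmissible) : E.arcB.Nonempty := by
  by_contra h
  rw [Set.not_nonempty_iff_eq_empty] at h
  have hall : E.zdArcA ⊆ E.zdArcB := by
    intro x hx
    refine ⟨E.zdArcA_subset_zdBoundary hx, ?_⟩
    rw [h, Metric.infDist_empty]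
    exact Metric.infDist_nonneg
  obtain ⟨x, hx⟩ := hE.zdArcA_nonempty
  exact Set.disjoint_left.1 hE.disjoint hx (hall hx)

/-- **Sites near a boundary point far from the arc are off its discrete arc.** If every point of
`T` is at distance `≥ r₀` from the boundary point `b`, the (nonempty) arc datum `A'` is within
Hausdorff distance `< r₀ / 4` of `T`, and the mesh point of `x` is within `r₀ / 4` of `b`, then `x`
is not on the discrete arc `zdDiscreteArc A'`: its mesh point is at distance `≥ r₀ / 2` from `A'`
but `< r₀ / 4` from `b ∈ ∂Ω ∖ A'`. -/
theorem not_mem_zdDiscreteArc_of_dist_lt {A' T : Set ℂ} {b : ℂ} {r₀ : ℝ}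
    (hT : ∀ z ∈ T, r₀ ≤ dist z b) (hb : b ∈ frontier E.Ω)
    (hH : hausdorffEDist A' T < ENNReal.ofReal (r₀ / 4)) (hA' : A'.Nonempty)
    {x : Site 2} (hx : dist (meshPoint E.δ x) b < r₀ / 4) : x ∉ E.zdDiscreteArc A' := by
  intro hxA
  have hr₀ : 0 < r₀ / 4 := by
    have : (0 : ℝ≥0∞) < ENNReal.ofReal (r₀ / 4) := lt_of_le_of_lt bot_le hH
    exact ENNReal.ofReal_pos.1 this
  have h1 := (E.mem_zdDiscreteArc_iff.1 hxA).2
  -- every point of `A'` is within `r₀ / 4` of a point of `T`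
  have hnear : ∀ z ∈ A', ∃ w ∈ T, dist z w < r₀ / 4 := by
    intro z hz
    obtain ⟨w, hwT, hw⟩ := Metric.exists_edist_lt_of_hausdorffEDist_lt hz hH
    refine ⟨w, hwT, ?_⟩
    rw [edist_dist] at hw
    exact (ENNReal.ofReal_lt_ofReal_iff hr₀).1 hw
  -- `b` is not on `A'`
  have hbA : b ∉ A' := by
    intro hbA
    obtain ⟨w, hwT, hw⟩ := hnear b hbA
    have := hT w hwT
    rw [dist_comm] at this
    linarith
  -- the distance to the rest of the boundary is small
  have h2 : infDist (meshPoint E.δ x) (frontier E.Ω \ A') ≤ dist (meshPoint E.δ x) b :=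
    Metric.infDist_le_dist_of_mem ⟨hb, hbA⟩
  -- the distance to `A'` is large
  have h3 : r₀ / 2 ≤ infDist (meshPoint E.δ x) A' := by
    rw [Metric.le_infDist hA']
    intro z hz
    obtain ⟨w, hwT, hw⟩ := hnear z hz
    have hwb := hT w hwT
    have htri : dist w b ≤ dist w z + dist z (meshPoint E.δ x) + dist (meshPoint E.δ x) b :=
      (dist_triangle w z b).trans (by linarith [dist_triangle z (meshPoint E.δ x) b])
    rw [dist_comm w z] at htri
    rw [dist_comm]
    linarith
  linarith

variable {D : DobrushinDomain} {Λ : ℝ → DiscreteDobrushin}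

/-- **Colouring near a point far from the arc `(ab)`.** For a discretisation family `Λ` of
`(D; a, b)`, a boundary point `b'` at distance `≥ r₀ > 0` from `D.arc 0`, and all small meshes `δ`
at which the datum is admissible: no site whose mesh point is within `r₀ / 4` of `b'` lies on the
discrete arc of `A`. -/
theorem eventually_not_mem_zdArcA :
    ∀ {D : DobrushinDomain} {Λ : ℝ → DiscreteDobrushin}, ZdDiscretisationFamily D Λ →
      ∀ {b' : ℂ}, b' ∈ frontier D.carrier → ∀ {r₀ : ℝ}, 0 < r₀ →
      (∀ z ∈ D.arc 0, r₀ ≤ dist z b') →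
      ∀ᶠ δ in 𝓝[>] (0 : ℝ), (Λ δ).IsZdAdmissible →
        ∀ x : Site 2, dist (meshPoint δ x) b' < r₀ / 4 → x ∉ (Λ δ).zdArcA := by
  intro D Λ hΛ b' hb' r₀ hr₀ hT
  have hpos : (0 : ℝ≥0∞) < ENNReal.ofReal (r₀ / 4) := ENNReal.ofReal_pos.2 (by positivity)
  have hev : ∀ᶠ δ in 𝓝[>] (0 : ℝ),
      hausdorffEDist (Λ δ).arcA (D.arc 0) < ENNReal.ofReal (r₀ / 4) :=
    hΛ.tendsto_arcA (Iio_mem_nhds hpos)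
  filter_upwards [hev] with δ hδ hadm x hx
  have hb'' : b' ∈ frontier (Λ δ).Ω := by rw [hΛ.Ω_eq]; exact hb'
  have hx' : dist (meshPoint (Λ δ).δ x) b' < r₀ / 4 := by rw [hΛ.δ_eq]; exact hx
  exact not_mem_zdDiscreteArc_of_dist_lt hT hb'' hδ (arcA_nonempty hadm) hx'

/-- **Colouring near a point far from the arc `(ba)`** (symmetric to
`eventually_not_mem_zdArcA`): for small admissible meshes no site whose mesh point is within
`r₀ / 4` of a boundary point `a'` at distance `≥ r₀` from `D.arc 1` lies on the discrete arc of
`B`. -/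
theorem eventually_not_mem_zdArcB (hΛ : ZdDiscretisationFamily D Λ) {a' : ℂ}
    (ha' : a' ∈ frontier D.carrier) {r₀ : ℝ} (hr₀ : 0 < r₀) (hT : ∀ z ∈ D.arc 1, r₀ ≤ dist z a') :
    ∀ᶠ δ in 𝓝[>] (0 : ℝ), (Λ δ).IsZdAdmissible →
      ∀ x : Site 2, dist (meshPoint δ x) a' < r₀ / 4 → x ∉ (Λ δ).zdArcB := by
  have hpos : (0 : ℝ≥0∞) < ENNReal.ofReal (r₀ / 4) := ENNReal.ofReal_pos.2 (by positivity)
  have hev : ∀ᶠ δ in 𝓝[>] (0 : ℝ),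
      hausdorffEDist (Λ δ).arcB (D.arc 1) < ENNReal.ofReal (r₀ / 4) :=
    hΛ.tendsto_arcB (Iio_mem_nhds hpos)
  filter_upwards [hev] with δ hδ hadm x hx
  have ha'' : a' ∈ frontier (Λ δ).Ω := by rw [hΛ.Ω_eq]; exact ha'
  have hx' : dist (meshPoint (Λ δ).δ x) a' < r₀ / 4 := by rw [hΛ.δ_eq]; exact hx
  exact not_mem_zdDiscreteArc_of_dist_lt hT ha'' hδ (arcB_nonempty hadm) hx'

end Summit.CriticalPhenomena.CardyFormulaZ2.Cruxes.ParafermionToSLESixFamilies.FaceKernel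

end
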